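import Summits.Ventures.PercRepro.C026CutVertexB2
import Summits.Ventures.PercRepro.C026PFunCorner
import Summits.Ventures.PercRepro.C026PFunCurveL2
import Summits.Ventures.PercRepro.C026ClassEdge

/-!
# `(E00)` across a cut vertex separating the probe from the live vertices (p6, gen 21)

mine-3's block lemma (MINE3-GLUING §39 (d) (i)) for the corner identity `(E00)` of THEOREM L2, on p5's
cut-vertex dictionary (`C026CutVertex`, `C026CutVertexB2`): let `v` be a cut vertex of the two-colouring
`side` (`IsGluing v v v side`) with the live vertices `a, b` on side `true` and the probe `c` on side
`false`, `G₁ = G.part side true ∋ a, b, v`, `G₂ = G.part side false ∋ v, c`.  Then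

  `pFun_liveCells_eq_cut :  (P_G)(0,0) with probe c  =  #{v ~ c}(G₂) · (P_{G₁})(0,0) with probe v`,

the general form of the pendant-probe identity `(P)_c(0,0) = ½·(P)_u(0,0)` (`C026PFunPendantProbe`,
whose `c`-side is a single edge: `#{v ~ c} = 1` and `G₁` has one edge fewer).

PROOF.  `(P)(0,0) = 2·Δ_CF + n(D,·)` (`pFun_liveCells_eq`); p5's THEOREM B (B2) factors the slack,
`Δ_CF(G; a, b, c) = #{v ~ c}(G₂) · Δ_CF(G₁; a, b, v)` (`slackCF_cut`), and the count `n(D,·)` factors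
the same way (`card_D_cut`: `c ~ a ∧ c ~ b` iff `c ~ v` on side `false` and `v ~ a ∧ v ~ b` on side
`true`, `conn_cut_iff_cross` + `card_filter_cut`).

CONSEQUENCES.  `(E00)` transfers from the block `G₁` (probe `v`) to `G` (probe `c`)
(`pFun_liveCells_nonneg_of_cut`), and conversely when `c` is joined to `v` at all
(`pFun_liveCells_nonneg_iff_of_cut`); THEOREM L2 at every band state of the probe and the live
vertices follows (`pFun_threeCells_nonneg_of_cut`); a new unconditional L2 class: the cut vertex
joined to a live vertex by an edge (`pFun_threeCells_nonneg_of_cut_edge`, p5's `(CF)` on edges).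
Together with p5's (B5) (`slackCF_nonneg_of_cut_c`: the probe separating the two live vertices), the
block structure of a skeleton towards its probe never obstructs THEOREM L2.
-/

namespace PercRepro

namespace MultiGraph

open Finset

variable {V E : Type*} {G : MultiGraph V E}

section Cut

variable [Fintype E] {v : V} {side : E → Bool}

open Classical in
/-- The count `n(D,·) = #{c ~ a ∧ c ~ b}` factors across the cut vertex: the `c`-side configurations
joining `c` to `v` times the `a, b`-side configurations of red type `D` with probe `v`. -/
theorem card_D_cut (hg : G.IsGluing v v v side) {a b c : V}
    (ha : G.OnSide side true a) (hb : G.OnSide side true b) (hc : G.OnSide side false c)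
    (hac : a ≠ c) (hbc : b ≠ c) :
    (univ.filter fun ω : Config E => G.Conn ω c a ∧ G.Conn ω c b).card =
      (univ.filter fun ω₂ : Config {e // side e = false} => (G.part side false).Conn ω₂ v c).card *
        (univ.filter fun ω₁ : Config {e // side e = true} =>
          (G.part side true).Conn ω₁ v a ∧ (G.part side true).Conn ω₁ v b).card := by
  have hft : false ≠ true := by decide
  have hfilt : (univ.filter fun ω : Config E => G.Conn ω c a ∧ G.Conn ω c b) =
      univ.filter fun ω : Config E =>
        ((G.part side true).Conn (sideRestrict ω side true) v a ∧
          (G.part side true).Conn (sideRestrict ω side true) v b) ∧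
        (G.part side false).Conn (sideRestrict ω side false) v c := by
    refine filter_congr fun ω _ => ?_
    rw [conn_cut_iff_cross hg hft (Or.inr hc) ha hac.symm ω,
      conn_cut_iff_cross hg hft (Or.inr hc) hb hbc.symm ω, conn_comm (u := c) (v := v)]
    tauto
  rw [hfilt, mul_comm]
  convert card_filter_cut side
    (fun ω₁ => (G.part side true).Conn ω₁ v a ∧ (G.part side true).Conn ω₁ v b)
    (fun ω₂ => (G.part side false).Conn ω₂ v c) using 5

variable [Fintype V] [DecidableEq V]

open Classical in
/-- **The corner value of `(P)` factors across a cut vertex** separating the probe from the live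
vertices: `(P_G)(0,0)` with probe `c` is `#{v ~ c}(G₂)` times `(P_{G₁})(0,0)` with probe `v`. -/
theorem pFun_liveCells_eq_cut (hg : G.IsGluing v v v side) {a b c : V}
    (ha : G.OnSide side true a) (hb : G.OnSide side true b) (hc : G.OnSide side false c)
    (hac : a ≠ c) (hbc : b ≠ c) :
    G.pFun c (liveCells a b) (liveCells a b) univ =
      ((univ.filter fun ω₂ : Config {e // side e = false} =>
          (G.part side false).Conn ω₂ v c).card : ℝ) *
        (G.part side true).pFun v (liveCells a b) (liveCells a b) univ := by
  rw [pFun_liveCells_eq, pFun_liveCells_eq, slackCF_cut hg ha hb hc hac hbc,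
    card_D_cut hg ha hb hc hac hbc]
  push_cast
  ring

open Classical in
/-- **`(E00)` transfers across a cut vertex** (mine-3's block lemma (i)): the corner identity of the
block `G₁ = G.part side true` with probe `v` gives the corner identity of `G` with probe `c`. -/
theorem pFun_liveCells_nonneg_of_cut (hg : G.IsGluing v v v side) {a b c : V}
    (ha : G.OnSide side true a) (hb : G.OnSide side true b) (hc : G.OnSide side false c)
    (hac : a ≠ c) (hbc : b ≠ c)
    (hv : 0 ≤ (G.part side true).pFun v (liveCells a b) (liveCells a b) univ) :
    0 ≤ G.pFun c (liveCells a b) (liveCells a b) univ := by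
  rw [pFun_liveCells_eq_cut hg ha hb hc hac hbc]
  exact mul_nonneg (Nat.cast_nonneg _) hv

open Classical in
/-- When some `c`-side configuration joins `c` to `v`, the two corner identities are equivalent. -/
theorem pFun_liveCells_nonneg_iff_of_cut (hg : G.IsGluing v v v side) {a b c : V}
    (ha : G.OnSide side true a) (hb : G.OnSide side true b) (hc : G.OnSide side false c)
    (hac : a ≠ c) (hbc : b ≠ c)
    (hK : 0 < (univ.filter fun ω₂ : Config {e // side e = false} =>
      (G.part side false).Conn ω₂ v c).card) :
    0 ≤ G.pFun c (liveCells a b) (liveCells a b) univ ↔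
      0 ≤ (G.part side true).pFun v (liveCells a b) (liveCells a b) univ := by
  rw [pFun_liveCells_eq_cut hg ha hb hc hac hbc]
  exact mul_nonneg_iff_of_pos_left (Nat.cast_pos.2 hK)

open Classical in
/-- **THEOREM L2 transfers across a cut vertex**: `(E00)` of the block with probe `v` gives
`(P) ≥ 0` at every band state of the probe `c` and the live vertices `a, b`. -/
theorem pFun_threeCells_nonneg_of_cut (hg : G.IsGluing v v v side) {a b c : V}
    (ha : G.OnSide side true a) (hb : G.OnSide side true b) (hc : G.OnSide side false c)
    (hac : a ≠ c) (hbc : b ≠ c)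
    (hv : 0 ≤ (G.part side true).pFun v (liveCells a b) (liveCells a b) univ)
    {z κ x₁ K₁ x₂ K₂ : ℝ} (hz : 0 ≤ z ∧ z ≤ 1) (hκ : kMin z ≤ κ) (hx₁ : 0 ≤ x₁ ∧ x₁ ≤ 1)
    (hx₂ : 0 ≤ x₂ ∧ x₂ ≤ 1) (hK₁ : kMin x₁ ≤ K₁) (hK₂ : kMin x₂ ≤ K₂) :
    0 ≤ G.pFun c (threeCells c a b z x₁ x₂) (threeCells c a b κ K₁ K₂) univ :=
  pFun_threeCells_nonneg_of_E00 c a b hz hκ hx₁ hx₂ hK₁ hK₂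
    (pFun_liveCells_nonneg_of_cut hg ha hb hc hac hbc hv)

open Classical in
/-- THEOREM L2 on every skeleton whose probe is separated from the live vertices by a cut vertex `v`
joined to a live vertex by an edge (the edge lies on the live side, `a` being there). -/
theorem pFun_threeCells_nonneg_of_cut_edge (hg : G.IsGluing v v v side) {a b c : V}
    (ha : G.OnSide side true a) (hb : G.OnSide side true b) (hc : G.OnSide side false c)
    (hac : a ≠ c) (hbc : b ≠ c) (e : E)
    (he : (G.fst e = v ∧ G.snd e = a) ∨ (G.fst e = a ∧ G.snd e = v))
    {z κ x₁ K₁ x₂ K₂ : ℝ} (hz : 0 ≤ z ∧ z ≤ 1) (hκ : kMin z ≤ κ) (hx₁ : 0 ≤ x₁ ∧ x₁ ≤ 1)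
    (hx₂ : 0 ≤ x₂ ∧ x₂ ≤ 1) (hK₁ : kMin x₁ ≤ K₁) (hK₂ : kMin x₂ ≤ K₂) :
    0 ≤ G.pFun c (threeCells c a b z x₁ x₂) (threeCells c a b κ K₁ K₂) univ := by
  have hs : side e = true := by
    rcases he with ⟨_, h2⟩ | ⟨h1, _⟩
    · exact ha e (Or.inr h2)
    · exact ha e (Or.inl h1)
  refine pFun_threeCells_nonneg_of_cut hg ha hb hc hac hbc ?_ hz hκ hx₁ hx₂ hK₁ hK₂
  refine pFun_liveCells_nonneg_of_slackCF a b v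
    (slackCF_nonneg_of_edge (G := G.part side true) ⟨e, hs⟩ ?_)
  simpa using he

end Cut

end MultiGraph

end PercRepro
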